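import Summits.CriticalPhenomena.PercolationContinuityZ3.Theses.PercBurnResprinkle
import Summits.CriticalPhenomena.PercolationContinuityZ3.Theorems.PercBurnResprinkleVacantSetPercolates

/-!
# Line `planar-armed-sections` — skeleton for the crux `VacantSetPercolates` (item stmt-CriticalPhenomena-7205), THIRD PASS

Lead: prover-line-stmt-CriticalPhenomena-7205-c2-0 (2026-08-16).  RESHAPED from the tree skeleton
`Cruxes/VacantSetPercolates/Lines/planar_armed_sections.lean` (lead prover-line-stmt-CriticalPhenomena-7205-0, 7 stubs, 6 landed)
now that everything provable of the line is IN THE TREE: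
`Theorems/PercBurnResprinkleVacantSetPercolates{CoarseLocality,CoarseShift,CoarseFootprint,CoarsePercolates,SquareCrossings,CoarseToVacant}.lean`
(p86540 p86803 p86858 p86899 p86804 p86817) and the composition `Theorems/PercBurnResprinkleVacantSetPercolates.lean` (p100551),
which proves the crux from the input in FOUR equivalent forms.  What changed and why:
* the six landed stubs are no longer stubs — they are imported theorems;
* the ONE open stub is re-registered in its weakest proved-equivalent form, the SINGLE-ORIENTATION ONE-PARAMETER planar
  quiet-crossing criterion at `p_c(ℤ³)` (`stub_planarQuietHalfScale` below; equivalent to the former `stub_planarArmedFSC` by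
  `planarArmedFSC_of_halfScaleQuietCrossings` / `halfScaleQuietCrossings_of_planarArmedFSC` / `halfScaleQuietCrossings_of_dir0` /
  `dir0_of_halfScaleQuietCrossings` of the composition file: monotonicity in the quietness scale + coordinate-swap symmetry);
* the composition is the landed `vacantSetPercolates_of_dir0HalfScaleQuietCrossings` — glue only.
Composition idea, objects and the input are the planner's and the first lead's, unchanged.

Crux (route `PercBurnResprinkle`): `∃ p ∈ (p_c(ℤ³), 1], P_p(0 lies in an infinite component of X = ℤ³[{y : C(y) finite}]) > 0`,
i.e. `p_c(ℤ³) < p_fin(3)` (Grimmett–Holroyd–Kozma 2014, open for `d = 3`; tree: `criticalProb_lt_pFin_iff`).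

THE OPEN STUB `stub_planarQuietHalfScale` (H).  For every `ε > 0` there is a block scale `N ≥ 3` such that, under `P_{p_c(ℤ³)}`,
the planar rectangle `[0,2N] × [0,N] × {0}` is crossed HORIZONTALLY (from `{w₀ = 0}` to `{w₀ = 2N}`) by a nearest-neighbour path of
`ℤ²` all of whose sites `w` are QUIET AT SCALE `(N-1)/2`: no open path from `(w,0)` reaches the boundary of the box
`(w,0) + Λ_{(N-1)/2}` inside that box (`planeEmb 3 w ∈ quietSet ((N-1)/2) ω`; such a site has a finite cluster, so the path lies in `X`).
Load-bearing profile (this pass, `Theorems/PercBurnResprinkleVacantSetPercolatesInputProfile.lean`): the criterion probability is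
antitone and continuous in `p` and tends to `1` as `N → ∞` at every `p < p_c(ℤ³)` (sharpness), so H ⟺ "that subcritical limit is
UNIFORM up to `p_c`"; H is numerically true (kit j006148, j012544: quiet crossings `0.93 → 1.00` with scale at fixed quietness 8).
Why it is crux-sized: any proof bounds an armed (connectivity) density AT `p_c(ℤ³)` from above — no such bound exists in `d = 3`
(density schemes need a one-arm exponent `> 2`, GHK's sparse version `> 1`; numerically `≈ 0.48`).

DISPROOF USED (`Cruxes/VacantSetPercolates/Disproof.lean`, cdisprove cycles 1–2, re-read 2026-08-16T16:00Z): no `_false_without_`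
theorem, no `-- Targets` section, no `Negative/` lemma; §7 `continuity_of_oneArm_decay` (H never bounds the one-arm probability —
it is a crossing probability of the quiet set at ONE scale per `ε`), `continuity_of_fullRecovery` (the composition gives positivity
at ONE `q > p_c`, not full recovery), §8 (dimension enters through H, whose `d = 2` analogue is false by RSW).
-/

namespace Summit.CriticalPhenomena.PercolationContinuityZ3.Cruxes.VacantSetPercolates.PlanarArmedSections

open MeasureTheory Set Filter
open scoped Topology
open Literature.Probability.Percolation Literature.Probability.LatticeModels
open Summit.CriticalPhenomena.PercolationContinuityZ3.Theorems

noncomputable section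

/-! ### The stub (registered; `sorry` only here) -/

/-- **`stub_planarQuietHalfScale` — THE INPUT (open; the only stub).**  Single-orientation, one-parameter planar
quiet-crossing criterion at `p_c(ℤ³)`: for every `ε > 0` some block scale `N ≥ 3` has
`P_{p_c}([0,2N] × [0,N] × {0}` is crossed horizontally by a lattice path of `(N-1)/2`-quiet sites`) ≥ 1 - ε`.
[cite: GrimmettHolroydKozma2014, §4 (Thm. 5: the finite-size input of the block argument); open for d = 3] -/
theorem stub_planarQuietHalfScale :
    ∀ ε : ℝ, 0 < ε → ∃ N : ℕ, 3 ≤ N ∧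
      1 - ε ≤ (bondPercolation (zdGraph 3) (criticalProbI 3)).real
      {ω | ∃ x y : Site 2, x 0 = 0 ∧ y 0 = 2 * (N : ℤ) ∧
      PathIn (zdGraph 2) ({w : Site 2 | (0 ≤ w 0 ∧ w 0 ≤ 2 * (N : ℤ)) ∧
      ∀ j : Fin 2, j ≠ 0 → 0 ≤ w j ∧ w j ≤ (N : ℤ)} ∩ {w | planeEmb 3 w ∈ quietSet ((N - 1) / 2) ω}) x y} := by
  sorry

/-! ### Composition (glue only; everything else is landed) -/

/-- **THE SKELETON THEOREM — the line concludes the crux BY NAME** from its one open stub, through the landed composition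
`vacantSetPercolates_of_dir0HalfScaleQuietCrossings` (p100551: continuity in `p` of the local criterion probability,
`p_c(ℤ³) < 1`, 5-dependent planar renormalisation of the quiet field via the tree's proved DST dependent-percolation fact,
planar gluing, lift to `X`). [cite: GrimmettHolroydKozma2014, §4 (Thm. 5)] -/
theorem VacantSetPercolates_of :
    Summit.CriticalPhenomena.PercolationContinuityZ3.Theses.PercBurnResprinkle.VacantSetPercolates :=
  vacantSetPercolates_of_dir0HalfScaleQuietCrossings stub_planarQuietHalfScale

end

end Summit.CriticalPhenomena.PercolationContinuityZ3.Cruxes.VacantSetPercolates.PlanarArmedSections
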